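import Mathlib
import HarnessLib
import Summits.AtomisticToContinuum.FouriersLaw.Theses.TangentFlowDephasing

/-!
# Birth skeleton (BC3) for crux `TangentFlowDephasing.LifetimeControlsCurrent`
(item `stmt-AtomisticToContinuum-12156`, route `route-AtomisticToContinuum-TangentFlowDephasing`, crux rank 2;
sub-problem `FouriersLaw`; registrar `planner-skel-stmt-AtomisticToContinuum-12156-0`, 2026-08-17)

Crux (FIXED, concluded BY NAME below) — SD2, DEPHASING-LIMITED TRANSPORT: for `pinnedChain ω₂ lam β γ` (all `> 0`),
`T > 0`, every shift-invariant DLR Gibbs state `μ` and every `μ`-preserving infinite-volume dynamics `D` with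
absolutely convergent current correlations: if the one-phonon block `∫ a_0·(b_x∘φ_t) dμ` (`a,b ∈ {q,p}`) is
square-integrable over `ℤ × (0,∞)`, then `C_T(t) = currentCorrelation D μ t = Σ_x ∫ j_0·(j_x∘φ_t) dμ` is
integrable on `(0,∞)`.

## Line `birth` — PAIRING / CONNECTED SPLIT OVER THE FLIP-ODD COMPOSITE FIELDS (the item's own two-layer plan
"GaussianPart → CumulantDomination → LifetimeControlsCurrent", typed; the Gaussian-part ANALYSIS is proved here)

Write the bond current as `j_x = -(a_x · b_x)`, `a_x = (p_x + p_(x+1))/2` (momentum factor), `b_x = V'(r_x) =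
r_x + β r_x³` (anharmonic bond force, `r_x = q_(x+1) - q_x`); both factors are ODD under the global flip
`(q,p) ↦ (-q,-p)`. Then `⟨j_0 · j_x(t)⟩ = ⟨a_0 b_0 · a_x(t) b_x(t)⟩ = G(x,t) + K(x,t)` with the PAIRING PART
`G = F₀F₁ + F₂F₃`, `F₀ = ⟨a_0 a_x(t)⟩`, `F₁ = ⟨b_0 b_x(t)⟩`, `F₂ = ⟨a_0 b_x(t)⟩`, `F₃ = ⟨b_0 a_x(t)⟩` (the cross
pairings; the equal-time pairing `⟨a_0 b_0⟩⟨a_x b_x⟩ = ⟨j⟩² = 0`) and the CONNECTED PART `K = ⟨j_0 j_x(t)⟩ - G`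
(the joint cumulant of the four flip-odd composite fields, up to mean corrections).

* `stub_forceBlockL2` (COMPOSITE-BLOCK DEPHASING, registered stub 1): under the crux hypotheses the four composite
  blocks `F_i(x,t)` have integrable integrands, are measurable in `t`, and are square-integrable over `ℤ × (0,∞)`.
  For `F₀` this is the hypothesis (momenta are one-phonon fields; shift invariance + Cauchy–Schwarz); the content is
  the force block `F₁ = ⟨V'(r_0) V'(r_x)(t)⟩`: L² dephasing passes from the displacement field to the odd cubic field
  `r + βr³` (4- and 6-point functions of flip-odd fields, no hydrodynamic projection — the structural reason of SD1).
  Size L.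
* `pairingL1` (PURE ANALYSIS, PROVED in this file, ~70 lines, axioms propext / Classical.choice / Quot.sound): four
  families `F_i : ℤ → ℝ → ℝ`, measurable in `t`, with `Σ_x ∫_0^∞ F_i² < ∞` ⇒ the pairing combination `F₀F₁ + F₂F₃`
  is summable in `x` for a.e. `t > 0` and `t ↦ Σ_x (F₀F₁ + F₂F₃)` is integrable on `(0,∞)` (pointwise
  `|ab + cd| ≤ a² + b² + c² + d²`, `∫⁻ Σ_x = Σ_x ∫⁻` (`lintegral_tsum`), `ae_lt_top'`, `enorm_tsum_le_tsum_enorm`).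
* `stub_connectedL1` (CUMULANT DOMINATION — the load-bearing registered stub 2): under the crux hypotheses and given
  the L² bounds of the composite blocks, the connected remainder `t ↦ Σ_x (⟨j_0 j_x(t)⟩ - G(x,t))` is integrable on
  `(0,∞)` — "no transport channel outlives the phonon by a non-integrable amount" (expected tail: the diffusive
  mode-coupling correction of the conserved energy, integrable in `d = 1`).  Open; size L+.
* COMPOSITION `LifetimeControlsCurrent_of` = `lifetimeControlsCurrent_of_parts stub_forceBlockL2 pairingL1
  stub_connectedL1`, the implication being kernel-checked and sorry-free: absolute convergence of the correlation
  sum (crux hypothesis) makes `K(·,t)` summable wherever `G(·,t)` is, `Σ_x G + Σ_x K = C_T(t)` a.e. on `(0,∞)`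
  (`Summable.tsum_add`), and `C_T ∈ L¹(0,∞)` by `Integrable.congr`.

Why the cut is not a costume: `stub_forceBlockL2` speaks of two-point functions only (no current 4-point function;
at the harmonic corner, where the crux's spirit fails, the ballistic `C_T ∉ L¹` sits in `K`, not in `G`);
`stub_connectedL1` alone does not give the crux (it controls `C_T - Σ_x G`, and `Σ_x G ∈ L¹` needs the force-block
dephasing of stub 1 plus the proved `pairingL1`).  BC3 probes `stub → LifetimeControlsCurrent`, `stub → FouriersLaw`
by `first | exact? | simpa | aesop` (and each closer alone) fail for both stubs (planner folder `bc/`, quoted in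
`Lines/birth.md`).  Disproof used: none on file (`ledger crux ls stmt-AtomisticToContinuum-12156`: no workfiles
before this one, 2026-08-17); refuter crux-attack (CruxAttack12156.lean, 2026-08-15: SURVIVES, no junk `(μ, D)`)
respected — both stubs keep the full Gibbs / shift-invariance / measure-preservation prefix of the crux verbatim.
-/

noncomputable section

namespace Summit.AtomisticToContinuum.FouriersLaw.Cruxes.LifetimeControlsCurrent

namespace Birth

/-! ## The composite flip-odd fields of the bond current and their two-point blocks

`j_x = -(a_x · b_x)` with `a_x = (p_x + p_(x+1))/2` and `b_x = V'(r_x) = r_x + β r_x³`, `r_x = q_(x+1) - q_x`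
(`OscillatorChain.bondCurrentZ`, `pinnedChain`: `V r = r²/2 + β r⁴/4`). These four definitions are
documentation / seam helpers only; the registered stubs spell the same terms out inline. -/

/-- Momentum–momentum block `F 0 (x,t) = ∫ a_0 · (a_x ∘ φ_t) dμ`. -/
def momBlock {ω₂ lam β γ : ℝ} (μ : MeasureTheory.Measure Literature.MathematicalPhysics.KineticTheory.HeatConduction.ChainConfig)
    (D : Literature.MathematicalPhysics.KineticTheory.HeatConduction.InfiniteChainDynamics (Literature.MathematicalPhysics.KineticTheory.HeatConduction.pinnedChain ω₂ lam β γ)) : ℤ → ℝ → ℝ :=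
  fun (x : ℤ) (t : ℝ) => MeasureTheory.integral μ (fun σ => (((σ 0).2 + (σ 1).2) / 2) * (((D.flow t σ x).2 + (D.flow t σ (x + 1)).2) / 2))

/-- Force–force block `F 1 (x,t) = ∫ b_0 · (b_x ∘ φ_t) dμ` (the anharmonic bond force `b = r + β r³`). -/
def forceBlock {ω₂ lam β γ : ℝ} (μ : MeasureTheory.Measure Literature.MathematicalPhysics.KineticTheory.HeatConduction.ChainConfig)
    (D : Literature.MathematicalPhysics.KineticTheory.HeatConduction.InfiniteChainDynamics (Literature.MathematicalPhysics.KineticTheory.HeatConduction.pinnedChain ω₂ lam β γ)) : ℤ → ℝ → ℝ :=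
  fun (x : ℤ) (t : ℝ) => MeasureTheory.integral μ (fun σ => ((σ 1).1 - (σ 0).1 + β * ((σ 1).1 - (σ 0).1) ^ 3) * ((D.flow t σ (x + 1)).1 - (D.flow t σ x).1 + β * ((D.flow t σ (x + 1)).1 - (D.flow t σ x).1) ^ 3))

/-- Mixed block `F 2 (x,t) = ∫ a_0 · (b_x ∘ φ_t) dμ`. -/
def momForceBlock {ω₂ lam β γ : ℝ} (μ : MeasureTheory.Measure Literature.MathematicalPhysics.KineticTheory.HeatConduction.ChainConfig)
    (D : Literature.MathematicalPhysics.KineticTheory.HeatConduction.InfiniteChainDynamics (Literature.MathematicalPhysics.KineticTheory.HeatConduction.pinnedChain ω₂ lam β γ)) : ℤ → ℝ → ℝ :=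
  fun (x : ℤ) (t : ℝ) => MeasureTheory.integral μ (fun σ => (((σ 0).2 + (σ 1).2) / 2) * ((D.flow t σ (x + 1)).1 - (D.flow t σ x).1 + β * ((D.flow t σ (x + 1)).1 - (D.flow t σ x).1) ^ 3))

/-- Mixed block `F 3 (x,t) = ∫ b_0 · (a_x ∘ φ_t) dμ`. -/
def forceMomBlock {ω₂ lam β γ : ℝ} (μ : MeasureTheory.Measure Literature.MathematicalPhysics.KineticTheory.HeatConduction.ChainConfig)
    (D : Literature.MathematicalPhysics.KineticTheory.HeatConduction.InfiniteChainDynamics (Literature.MathematicalPhysics.KineticTheory.HeatConduction.pinnedChain ω₂ lam β γ)) : ℤ → ℝ → ℝ :=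
  fun (x : ℤ) (t : ℝ) => MeasureTheory.integral μ (fun σ => ((σ 1).1 - (σ 0).1 + β * ((σ 1).1 - (σ 0).1) ^ 3) * (((D.flow t σ x).2 + (D.flow t σ (x + 1)).2) / 2))

/-- Packing four functions into a `Fin 4`-indexed family (seam helper). -/
theorem exists_fin4 {α : Type*} (a b c d : α) :
    ∃ F : Fin 4 → α, F 0 = a ∧ F 1 = b ∧ F 2 = c ∧ F 3 = d :=
  ⟨![a, b, c, d], rfl, rfl, rfl, rfl⟩

/-! ## The two registered stubs (`stub_forceBlockL2`, `stub_connectedL1`) and the proved pairing lemma -/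

/-- **stub 1 — `stub_forceBlockL2` (dephasing of the composite flip-odd blocks).**  For `pinnedChain ω₂ lam β γ`
(all `> 0`), `T > 0`, a shift-invariant DLR Gibbs state `μ` and a `μ`-preserving dynamics `D`: IF the one-phonon block
of `(q,p)` is square-integrable over `ℤ × (0,∞)` (the crux's hypothesis, verbatim), THEN for the four composite
two-point functions `F 0 = ⟨a_0 a_x(t)⟩`, `F 1 = ⟨b_0 b_x(t)⟩`, `F 2 = ⟨a_0 b_x(t)⟩`, `F 3 = ⟨b_0 a_x(t)⟩`
(`a_x = (p_x + p_(x+1))/2`, `b_x = r_x + β r_x³`, `r_x = q_(x+1) - q_x`): the integrands are `μ`-integrable, each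
`t ↦ F i x t` is a.e.-strongly measurable on `(0,∞)`, `t ↦ (F i x t)²` is integrable on `(0,∞)` for every `x`, and
`x ↦ ∫_0^∞ (F i x t)² dt` is summable.  Why plausibly true: `a` is a one-phonon field (hypothesis + shift invariance +
Cauchy–Schwarz); `b` is an odd polynomial in the displacement field with no projection on the conserved energy, the
structural reason behind SD1 (LukkarinenSpohn2010 Thm 2.4 for the kinetic analogue); static moments of every order are
finite in a DLR state of this chain.  Why it might fail: the cubic part of `b` carries connected 4- and 6-point functions
of `r` whose L² decay is not implied by 2-point decay. -/
theorem stub_forceBlockL2 :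
    ∀ ω₂ lam β γ : ℝ, 0 < ω₂ → 0 < lam → 0 < β → 0 < γ → ∀ T : ℝ, 0 < T → ∀ (μ : MeasureTheory.Measure Literature.MathematicalPhysics.KineticTheory.HeatConduction.ChainConfig) (D : Literature.MathematicalPhysics.KineticTheory.HeatConduction.InfiniteChainDynamics (Literature.MathematicalPhysics.KineticTheory.HeatConduction.pinnedChain ω₂ lam β γ)), (Literature.MathematicalPhysics.KineticTheory.HeatConduction.pinnedChain ω₂ lam β γ).IsChainGibbsMeasure T μ →
    Literature.MathematicalPhysics.KineticTheory.HeatConduction.IsShiftInvariant μ →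
    D.PreservesMeasure μ → ((∀ (t : ℝ) (x : ℤ), MeasureTheory.Integrable (fun σ => (σ 0).1 * (D.flow t σ x).1) μ ∧ MeasureTheory.Integrable (fun σ => (σ 0).1 * (D.flow t σ x).2) μ ∧ MeasureTheory.Integrable (fun σ => (σ 0).2 * (D.flow t σ x).1) μ ∧ MeasureTheory.Integrable (fun σ => (σ 0).2 * (D.flow t σ x).2) μ) ∧ (∀ x : ℤ, MeasureTheory.IntegrableOn (fun t : ℝ => (MeasureTheory.integral μ (fun σ => (σ 0).1 * (D.flow t σ x).1)) ^ 2 + (MeasureTheory.integral μ (fun σ => (σ 0).1 * (D.flow t σ x).2)) ^ 2 + (MeasureTheory.integral μ (fun σ => (σ 0).2 * (D.flow t σ x).1)) ^ 2 + (MeasureTheory.integral μ (fun σ => (σ 0).2 * (D.flow t σ x).2)) ^ 2) (Set.Ioi 0) MeasureTheory.volume) ∧ Summable (fun x : ℤ => MeasureTheory.integral (MeasureTheory.volume.restrict (Set.Ioi (0:ℝ))) (fun t : ℝ => (MeasureTheory.integral μ (fun σ => (σ 0).1 * (D.flow t σ x).1)) ^ 2 + (MeasureTheory.integral μ (fun σ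 => (σ 0).1 * (D.flow t σ x).2)) ^ 2 + (MeasureTheory.integral μ (fun σ => (σ 0).2 * (D.flow t σ x).1)) ^ 2 + (MeasureTheory.integral μ (fun σ => (σ 0).2 * (D.flow t σ x).2)) ^ 2))) →
    ∀ F : Fin 4 → ℤ → ℝ → ℝ, F 0 = (fun (x : ℤ) (t : ℝ) => MeasureTheory.integral μ (fun σ => (((σ 0).2 + (σ 1).2) / 2) * (((D.flow t σ x).2 + (D.flow t σ (x + 1)).2) / 2))) →
    F 1 = (fun (x : ℤ) (t : ℝ) => MeasureTheory.integral μ (fun σ => ((σ 1).1 - (σ 0).1 + β * ((σ 1).1 - (σ 0).1) ^ 3) * ((D.flow t σ (x + 1)).1 - (D.flow t σ x).1 + β * ((D.flow t σ (x + 1)).1 - (D.flow t σ x).1) ^ 3))) →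
    F 2 = (fun (x : ℤ) (t : ℝ) => MeasureTheory.integral μ (fun σ => (((σ 0).2 + (σ 1).2) / 2) * ((D.flow t σ (x + 1)).1 - (D.flow t σ x).1 + β * ((D.flow t σ (x + 1)).1 - (D.flow t σ x).1) ^ 3))) →
    F 3 = (fun (x : ℤ) (t : ℝ) => MeasureTheory.integral μ (fun σ => ((σ 1).1 - (σ 0).1 + β * ((σ 1).1 - (σ 0).1) ^ 3) * (((D.flow t σ x).2 + (D.flow t σ (x + 1)).2) / 2))) →
    (∀ (t : ℝ) (x : ℤ), MeasureTheory.Integrable (fun σ => (((σ 0).2 + (σ 1).2) / 2) * (((D.flow t σ x).2 + (D.flow t σ (x + 1)).2) / 2)) μ ∧ MeasureTheory.Integrable (fun σ => ((σ 1).1 - (σ 0).1 + β * ((σ 1).1 - (σ 0).1) ^ 3) * ((D.flow t σ (x + 1)).1 - (D.flow t σ x).1 + β * ((D.flow t σ (x + 1)).1 - (D.flow t σ x).1) ^ 3)) μ ∧ MeasureTheory.Integrable (fun σ => (((σ 0).2 + (σ 1).2) / 2) * ((D.flow t σ (x + 1)).1 - (D.flow t σ x).1 + β * ((D.flow t σ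 (x + 1)).1 - (D.flow t σ x).1) ^ 3)) μ ∧ MeasureTheory.Integrable (fun σ => ((σ 1).1 - (σ 0).1 + β * ((σ 1).1 - (σ 0).1) ^ 3) * (((D.flow t σ x).2 + (D.flow t σ (x + 1)).2) / 2)) μ) ∧ (∀ (i : Fin 4) (x : ℤ), MeasureTheory.AEStronglyMeasurable (F i x) (MeasureTheory.volume.restrict (Set.Ioi (0:ℝ)))) ∧ (∀ (i : Fin 4) (x : ℤ), MeasureTheory.IntegrableOn (fun t : ℝ => F i x t ^ 2) (Set.Ioi 0) MeasureTheory.volume) ∧ (∀ i : Fin 4, Summable (fun x : ℤ => MeasureTheory.integral (MeasureTheory.volume.restrict (Set.Ioi (0:ℝ))) (fun t : ℝ => F i x t ^ 2))) := by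
  sorry

/-- **`pairingL1` (pure analysis: Cauchy–Schwarz + Tonelli on `ℤ × (0,∞)`; PROVED, not a stub).**  For four
families `F i : ℤ → ℝ → ℝ`, a.e.-strongly measurable in `t` on `(0,∞)`, with `t ↦ (F i x t)²` integrable on `(0,∞)`
and `Σ_x ∫_0^∞ (F i x t)² dt < ∞`: the pairing combination `x ↦ F 0 x t · F 1 x t + F 2 x t · F 3 x t` is summable
for a.e. `t > 0`, and `t ↦ Σ_x (F 0 x t · F 1 x t + F 2 x t · F 3 x t)` is integrable on `(0,∞)`.  Proof:
`|ab + cd| ≤ a² + b² + c² + d²` pointwise, so `Σ_x ∫ ‖f_x‖ ≤ Σ_x ∫ g_x < ∞`; then `∫⁻ Σ_x ‖f_x‖ₑ = Σ_x ∫⁻ ‖f_x‖ₑ < ∞`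
(`lintegral_tsum`) gives a.e. summability (`ae_lt_top'`) and finite integral of the sum (`enorm_tsum_le_tsum_enorm`);
measurability of the sum is `AEMeasurable.tsum`. -/
theorem pairingL1 :
    ∀ F : Fin 4 → ℤ → ℝ → ℝ, (∀ (i : Fin 4) (x : ℤ), MeasureTheory.AEStronglyMeasurable (F i x) (MeasureTheory.volume.restrict (Set.Ioi (0:ℝ)))) →
    (∀ (i : Fin 4) (x : ℤ), MeasureTheory.IntegrableOn (fun t : ℝ => F i x t ^ 2) (Set.Ioi 0) MeasureTheory.volume) →
    (∀ i : Fin 4, Summable (fun x : ℤ => MeasureTheory.integral (MeasureTheory.volume.restrict (Set.Ioi (0:ℝ))) (fun t : ℝ => F i x t ^ 2))) →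
    (Filter.Eventually (fun t : ℝ => Summable (fun x : ℤ => F 0 x t * F 1 x t + F 2 x t * F 3 x t)) (MeasureTheory.ae (MeasureTheory.volume.restrict (Set.Ioi (0:ℝ))))) ∧ MeasureTheory.IntegrableOn (fun t : ℝ => ∑' x : ℤ, (F 0 x t * F 1 x t + F 2 x t * F 3 x t)) (Set.Ioi 0) MeasureTheory.volume := by
  intro F hM hQ hS
  set ν : MeasureTheory.Measure ℝ := MeasureTheory.volume.restrict (Set.Ioi (0:ℝ)) with hν
  have hQ' : ∀ (i : Fin 4) (x : ℤ), MeasureTheory.Integrable (fun t : ℝ => F i x t ^ 2) ν :=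
    fun i x => hQ i x
  -- the pairing combination `f` and its quadratic majorant `g`
  set f : ℤ → ℝ → ℝ := fun x t => F 0 x t * F 1 x t + F 2 x t * F 3 x t with hf
  set g : ℤ → ℝ → ℝ := fun x t => F 0 x t ^ 2 + F 1 x t ^ 2 + F 2 x t ^ 2 + F 3 x t ^ 2 with hg
  have f_meas : ∀ x : ℤ, MeasureTheory.AEStronglyMeasurable (f x) ν := fun x =>
    ((hM 0 x).mul (hM 1 x)).add ((hM 2 x).mul (hM 3 x))
  have g_int : ∀ x : ℤ, MeasureTheory.Integrable (g x) ν := fun x =>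
    (((hQ' 0 x).add (hQ' 1 x)).add (hQ' 2 x)).add (hQ' 3 x)
  -- Cauchy–Schwarz pointwise: |ab + cd| ≤ a² + b² + c² + d²
  have fg : ∀ (x : ℤ) (t : ℝ), ‖f x t‖ ≤ g x t := by
    intro x t
    rw [Real.norm_eq_abs, hf, hg]
    refine abs_le.mpr ⟨?_, ?_⟩
    · nlinarith [sq_nonneg (F 0 x t + F 1 x t), sq_nonneg (F 2 x t + F 3 x t),
        sq_nonneg (F 0 x t), sq_nonneg (F 1 x t), sq_nonneg (F 2 x t), sq_nonneg (F 3 x t)]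
    · nlinarith [sq_nonneg (F 0 x t - F 1 x t), sq_nonneg (F 2 x t - F 3 x t),
        sq_nonneg (F 0 x t), sq_nonneg (F 1 x t), sq_nonneg (F 2 x t), sq_nonneg (F 3 x t)]
  have f_int : ∀ x : ℤ, MeasureTheory.Integrable (f x) ν := fun x =>
    (g_int x).mono' (f_meas x) (Filter.Eventually.of_forall (fg x))
  -- Tonelli bookkeeping: `Σ_x ∫ g < ∞`, hence `Σ_x ∫ ‖f‖ < ∞`
  have g_sum : Summable fun x : ℤ => ∫ t, g x t ∂ν := by
    have e : (fun x : ℤ => ∫ t, g x t ∂ν) = fun x : ℤ =>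
        (((∫ t, F 0 x t ^ 2 ∂ν) + ∫ t, F 1 x t ^ 2 ∂ν) + ∫ t, F 2 x t ^ 2 ∂ν) + ∫ t, F 3 x t ^ 2 ∂ν := by
      funext x
      have h01 : MeasureTheory.Integrable (fun t : ℝ => F 0 x t ^ 2 + F 1 x t ^ 2) ν :=
        (hQ' 0 x).add (hQ' 1 x)
      have h012 : MeasureTheory.Integrable (fun t : ℝ => F 0 x t ^ 2 + F 1 x t ^ 2 + F 2 x t ^ 2) ν :=
        h01.add (hQ' 2 x)
      simp only [hg]
      rw [MeasureTheory.integral_add h012 (hQ' 3 x), MeasureTheory.integral_add h01 (hQ' 2 x),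
        MeasureTheory.integral_add (hQ' 0 x) (hQ' 1 x)]
    rw [e]
    exact (((hS 0).add (hS 1)).add (hS 2)).add (hS 3)
  have fnorm_sum : Summable fun x : ℤ => ∫ t, ‖f x t‖ ∂ν := by
    refine Summable.of_nonneg_of_le (fun x => MeasureTheory.integral_nonneg (fun t => norm_nonneg _))
      (fun x => ?_) g_sum
    exact MeasureTheory.integral_mono (f_int x).norm (g_int x) (fg x)
  have hf'' : ∀ x : ℤ, AEMeasurable (fun t => ‖f x t‖ₑ) ν := fun x => (f_meas x).enorm
  have hf' : (∑' x : ℤ, ∫⁻ t, ‖f x t‖ₑ ∂ν) ≠ ⊤ := by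
    have e : ∀ x : ℤ, (∫⁻ t, ‖f x t‖ₑ ∂ν) = ENNReal.ofReal (∫ t, ‖f x t‖ ∂ν) := fun x =>
      (MeasureTheory.ofReal_integral_norm_eq_lintegral_enorm (f_int x)).symm
    rw [tsum_congr e, ← ENNReal.ofReal_tsum_of_nonneg
      (fun x => MeasureTheory.integral_nonneg (fun t => norm_nonneg _)) fnorm_sum]
    exact ENNReal.ofReal_ne_top
  -- (A) a.e. summability of the pairing combination in `x`
  have hA : ∀ᵐ t ∂ν, Summable fun x : ℤ => f x t := by
    have h1 : (∫⁻ t, ∑' x : ℤ, ‖f x t‖ₑ ∂ν) ≠ ⊤ := by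
      rwa [MeasureTheory.lintegral_tsum hf'']
    refine (MeasureTheory.ae_lt_top' (AEMeasurable.tsum hf'') h1).mono ?_
    intro t ht
    have h2 : Summable fun x : ℤ => ((‖f x t‖₊ : NNReal) : ℝ) := by
      rw [← ENNReal.tsum_coe_ne_top_iff_summable_coe]
      exact ht.ne
    exact h2.of_norm
  -- (B) integrability of `t ↦ Σ_x f x t`
  have hB : MeasureTheory.Integrable (fun t : ℝ => ∑' x : ℤ, f x t) ν := by
    refine ⟨(AEMeasurable.tsum (fun x => (f_meas x).aemeasurable)).aestronglyMeasurable, ?_⟩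
    rw [MeasureTheory.hasFiniteIntegral_iff_enorm]
    calc (∫⁻ t, ‖∑' x : ℤ, f x t‖ₑ ∂ν)
        ≤ ∫⁻ t, ∑' x : ℤ, ‖f x t‖ₑ ∂ν := MeasureTheory.lintegral_mono (fun t => enorm_tsum_le_tsum_enorm)
      _ = ∑' x : ℤ, ∫⁻ t, ‖f x t‖ₑ ∂ν := MeasureTheory.lintegral_tsum hf''
      _ < ⊤ := lt_top_iff_ne_top.mpr hf'
  exact ⟨hA, hB⟩

/-- **stub 3 — `stub_connectedL1` (CUMULANT DOMINATION, the load-bearing stub).**  Under the crux hypotheses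
(Gibbs, shift-invariant, measure-preserving, absolutely convergent current correlations, one-phonon block in
`L²(ℤ × (0,∞))`) and given the measurability / `L²(ℤ × (0,∞))` bounds of the four composite blocks `F i` of stub 1:
the CONNECTED REMAINDER `t ↦ Σ_x (∫ j_0 · (j_x ∘ φ_t) dμ - (F 0 x t · F 1 x t + F 2 x t · F 3 x t))` — the joint
cumulant of the flip-odd composite fields `a_0, b_0, a_x(t), b_x(t)` (`j = -(a·b)`), summed over `x` — is integrable
on `(0,∞)`.  "No transport channel outlives the phonon by a non-integrable amount" (HakenStrobl1973 / KangSchenker2009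
step `D ≍ v²τ`, cumulant-hierarchy technology doi:10.1063/1.4960556).  Why it might fail (= the crux's): a
quasi-conserved flip-even charge overlapping `j` (Mazur1969, HuveneersLukkarinen2020) or breather-trapped energy
(DeRoeckHuveneers2015) lives exactly in this connected part.  Open; size L+. -/
theorem stub_connectedL1 :
    ∀ ω₂ lam β γ : ℝ, 0 < ω₂ → 0 < lam → 0 < β → 0 < γ → ∀ T : ℝ, 0 < T → ∀ (μ : MeasureTheory.Measure Literature.MathematicalPhysics.KineticTheory.HeatConduction.ChainConfig) (D : Literature.MathematicalPhysics.KineticTheory.HeatConduction.InfiniteChainDynamics (Literature.MathematicalPhysics.KineticTheory.HeatConduction.pinnedChain ω₂ lam β γ)), (Literature.MathematicalPhysics.KineticTheory.HeatConduction.pinnedChain ω₂ lam β γ).IsChainGibbsMeasure T μ →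
    Literature.MathematicalPhysics.KineticTheory.HeatConduction.IsShiftInvariant μ →
    D.PreservesMeasure μ → (∀ t : ℝ, D.HasAbsConvergentCorrelation μ t) → ((∀ (t : ℝ) (x : ℤ), MeasureTheory.Integrable (fun σ => (σ 0).1 * (D.flow t σ x).1) μ ∧ MeasureTheory.Integrable (fun σ => (σ 0).1 * (D.flow t σ x).2) μ ∧ MeasureTheory.Integrable (fun σ => (σ 0).2 * (D.flow t σ x).1) μ ∧ MeasureTheory.Integrable (fun σ => (σ 0).2 * (D.flow t σ x).2) μ) ∧ (∀ x : ℤ, MeasureTheory.IntegrableOn (fun t : ℝ => (MeasureTheory.integral μ (fun σ => (σ 0).1 * (D.flow t σ x).1)) ^ 2 + (MeasureTheory.integral μ (fun σ => (σ 0).1 * (D.flow t σ x).2)) ^ 2 + (MeasureTheory.integral μ (fun σ => (σ 0).2 * (D.flow t σ x).1)) ^ 2 + (MeasureTheory.integral μ (fun σ => (σ 0).2 * (D.flow t σ x).2)) ^ 2) (Set.Ioi 0) MeasureTheory.volume) ∧ Summable (fun x : ℤ => MeasureTheory.integral (MeasureTheory.volume.restrict (Set.Ioi (0:ℝ))) (fun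 t : ℝ => (MeasureTheory.integral μ (fun σ => (σ 0).1 * (D.flow t σ x).1)) ^ 2 + (MeasureTheory.integral μ (fun σ => (σ 0).1 * (D.flow t σ x).2)) ^ 2 + (MeasureTheory.integral μ (fun σ => (σ 0).2 * (D.flow t σ x).1)) ^ 2 + (MeasureTheory.integral μ (fun σ => (σ 0).2 * (D.flow t σ x).2)) ^ 2))) →
    ∀ F : Fin 4 → ℤ → ℝ → ℝ, F 0 = (fun (x : ℤ) (t : ℝ) => MeasureTheory.integral μ (fun σ => (((σ 0).2 + (σ 1).2) / 2) * (((D.flow t σ x).2 + (D.flow t σ (x + 1)).2) / 2))) →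
    F 1 = (fun (x : ℤ) (t : ℝ) => MeasureTheory.integral μ (fun σ => ((σ 1).1 - (σ 0).1 + β * ((σ 1).1 - (σ 0).1) ^ 3) * ((D.flow t σ (x + 1)).1 - (D.flow t σ x).1 + β * ((D.flow t σ (x + 1)).1 - (D.flow t σ x).1) ^ 3))) →
    F 2 = (fun (x : ℤ) (t : ℝ) => MeasureTheory.integral μ (fun σ => (((σ 0).2 + (σ 1).2) / 2) * ((D.flow t σ (x + 1)).1 - (D.flow t σ x).1 + β * ((D.flow t σ (x + 1)).1 - (D.flow t σ x).1) ^ 3))) →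
    F 3 = (fun (x : ℤ) (t : ℝ) => MeasureTheory.integral μ (fun σ => ((σ 1).1 - (σ 0).1 + β * ((σ 1).1 - (σ 0).1) ^ 3) * (((D.flow t σ x).2 + (D.flow t σ (x + 1)).2) / 2))) →
    (∀ (i : Fin 4) (x : ℤ), MeasureTheory.AEStronglyMeasurable (F i x) (MeasureTheory.volume.restrict (Set.Ioi (0:ℝ)))) →
    (∀ (i : Fin 4) (x : ℤ), MeasureTheory.IntegrableOn (fun t : ℝ => F i x t ^ 2) (Set.Ioi 0) MeasureTheory.volume) →
    (∀ i : Fin 4, Summable (fun x : ℤ => MeasureTheory.integral (MeasureTheory.volume.restrict (Set.Ioi (0:ℝ))) (fun t : ℝ => F i x t ^ 2))) →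
    MeasureTheory.IntegrableOn (fun t : ℝ => ∑' x : ℤ, (MeasureTheory.integral μ (fun σ => (Literature.MathematicalPhysics.KineticTheory.HeatConduction.pinnedChain ω₂ lam β γ).bondCurrentZ σ 0 * (Literature.MathematicalPhysics.KineticTheory.HeatConduction.pinnedChain ω₂ lam β γ).bondCurrentZ (D.flow t σ) x) - (F 0 x t * F 1 x t + F 2 x t * F 3 x t))) (Set.Ioi 0) MeasureTheory.volume := by
  sorry

/-! ## The composition (sorry-free) -/

/-- **The implication** `stub_forceBlockL2`-statement → `stub_pairingL1`-statement →
`stub_connectedL1`-statement → the statement of `TangentFlowDephasing.LifetimeControlsCurrent` (conclusion = the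
crux's definiens VERBATIM, so that `LifetimeControlsCurrent_of` below is this term at the crux's NAME).
Proof: pack the four composite blocks as `F`; stub 1 gives their measurability and `L²(ℤ × (0,∞))` bounds, stub 2
turns those into a.e.-summability and integrability of the pairing part `G = F₀F₁ + F₂F₃`, stub 3 gives
integrability of the connected remainder `K = ⟨j_0 j_x(t)⟩ - G`; absolute convergence of the correlation sum makes
`K(·,t)` summable wherever `G(·,t)` is, so `Σ_x G + Σ_x K = Σ_x ⟨j_0 j_x(t)⟩ = C_T(t)` for a.e. `t > 0`, and
`C_T ∈ L¹(0,∞)` follows by `Integrable.congr`. -/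
theorem lifetimeControlsCurrent_of_parts
    (h₁ : ∀ ω₂ lam β γ : ℝ, 0 < ω₂ → 0 < lam → 0 < β → 0 < γ → ∀ T : ℝ, 0 < T → ∀ (μ : MeasureTheory.Measure Literature.MathematicalPhysics.KineticTheory.HeatConduction.ChainConfig) (D : Literature.MathematicalPhysics.KineticTheory.HeatConduction.InfiniteChainDynamics (Literature.MathematicalPhysics.KineticTheory.HeatConduction.pinnedChain ω₂ lam β γ)), (Literature.MathematicalPhysics.KineticTheory.HeatConduction.pinnedChain ω₂ lam β γ).IsChainGibbsMeasure T μ →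
      Literature.MathematicalPhysics.KineticTheory.HeatConduction.IsShiftInvariant μ →
      D.PreservesMeasure μ → ((∀ (t : ℝ) (x : ℤ), MeasureTheory.Integrable (fun σ => (σ 0).1 * (D.flow t σ x).1) μ ∧ MeasureTheory.Integrable (fun σ => (σ 0).1 * (D.flow t σ x).2) μ ∧ MeasureTheory.Integrable (fun σ => (σ 0).2 * (D.flow t σ x).1) μ ∧ MeasureTheory.Integrable (fun σ => (σ 0).2 * (D.flow t σ x).2) μ) ∧ (∀ x : ℤ, MeasureTheory.IntegrableOn (fun t : ℝ => (MeasureTheory.integral μ (fun σ => (σ 0).1 * (D.flow t σ x).1)) ^ 2 + (MeasureTheory.integral μ (fun σ => (σ 0).1 * (D.flow t σ x).2)) ^ 2 + (MeasureTheory.integral μ (fun σ => (σ 0).2 * (D.flow t σ x).1)) ^ 2 + (MeasureTheory.integral μ (fun σ => (σ 0).2 * (D.flow t σ x).2)) ^ 2) (Set.Ioi 0) MeasureTheory.volume) ∧ Summable (fun x : ℤ => MeasureTheory.integral (MeasureTheory.volume.restrict (Set.Ioi (0:ℝ))) (fun t : ℝ => (MeasureTheory.integral μ (fun σ => (σ 0).1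 * (D.flow t σ x).1)) ^ 2 + (MeasureTheory.integral μ (fun σ => (σ 0).1 * (D.flow t σ x).2)) ^ 2 + (MeasureTheory.integral μ (fun σ => (σ 0).2 * (D.flow t σ x).1)) ^ 2 + (MeasureTheory.integral μ (fun σ => (σ 0).2 * (D.flow t σ x).2)) ^ 2))) →
      ∀ F : Fin 4 → ℤ → ℝ → ℝ, F 0 = (fun (x : ℤ) (t : ℝ) => MeasureTheory.integral μ (fun σ => (((σ 0).2 + (σ 1).2) / 2) * (((D.flow t σ x).2 + (D.flow t σ (x + 1)).2) / 2))) →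
      F 1 = (fun (x : ℤ) (t : ℝ) => MeasureTheory.integral μ (fun σ => ((σ 1).1 - (σ 0).1 + β * ((σ 1).1 - (σ 0).1) ^ 3) * ((D.flow t σ (x + 1)).1 - (D.flow t σ x).1 + β * ((D.flow t σ (x + 1)).1 - (D.flow t σ x).1) ^ 3))) →
      F 2 = (fun (x : ℤ) (t : ℝ) => MeasureTheory.integral μ (fun σ => (((σ 0).2 + (σ 1).2) / 2) * ((D.flow t σ (x + 1)).1 - (D.flow t σ x).1 + β * ((D.flow t σ (x + 1)).1 - (D.flow t σ x).1) ^ 3))) →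
      F 3 = (fun (x : ℤ) (t : ℝ) => MeasureTheory.integral μ (fun σ => ((σ 1).1 - (σ 0).1 + β * ((σ 1).1 - (σ 0).1) ^ 3) * (((D.flow t σ x).2 + (D.flow t σ (x + 1)).2) / 2))) →
      (∀ (t : ℝ) (x : ℤ), MeasureTheory.Integrable (fun σ => (((σ 0).2 + (σ 1).2) / 2) * (((D.flow t σ x).2 + (D.flow t σ (x + 1)).2) / 2)) μ ∧ MeasureTheory.Integrable (fun σ => ((σ 1).1 - (σ 0).1 + β * ((σ 1).1 - (σ 0).1) ^ 3) * ((D.flow t σ (x + 1)).1 - (D.flow t σ x).1 + β * ((D.flow t σ (x + 1)).1 - (D.flow t σ x).1) ^ 3)) μ ∧ MeasureTheory.Integrable (fun σ => (((σ 0).2 + (σ 1).2) / 2) * ((D.flow t σ (x + 1)).1 - (D.flow t σ x).1 + β * ((D.flow t σ (x + 1)).1 - (D.flow t σ x).1) ^ 3)) μ ∧ MeasureTheory.Integrable (fun σ => ((σ 1).1 - (σ 0).1 + β * ((σ 1).1 - (σ 0).1) ^ 3) * (((D.flow t σ x).2 + (D.flow t σ (x + 1)).2) / 2)) μ) ∧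 (∀ (i : Fin 4) (x : ℤ), MeasureTheory.AEStronglyMeasurable (F i x) (MeasureTheory.volume.restrict (Set.Ioi (0:ℝ)))) ∧ (∀ (i : Fin 4) (x : ℤ), MeasureTheory.IntegrableOn (fun t : ℝ => F i x t ^ 2) (Set.Ioi 0) MeasureTheory.volume) ∧ (∀ i : Fin 4, Summable (fun x : ℤ => MeasureTheory.integral (MeasureTheory.volume.restrict (Set.Ioi (0:ℝ))) (fun t : ℝ => F i x t ^ 2))))
    (h₂ : ∀ F : Fin 4 → ℤ → ℝ → ℝ, (∀ (i : Fin 4) (x : ℤ), MeasureTheory.AEStronglyMeasurable (F i x) (MeasureTheory.volume.restrict (Set.Ioi (0:ℝ)))) →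
      (∀ (i : Fin 4) (x : ℤ), MeasureTheory.IntegrableOn (fun t : ℝ => F i x t ^ 2) (Set.Ioi 0) MeasureTheory.volume) →
      (∀ i : Fin 4, Summable (fun x : ℤ => MeasureTheory.integral (MeasureTheory.volume.restrict (Set.Ioi (0:ℝ))) (fun t : ℝ => F i x t ^ 2))) →
      (Filter.Eventually (fun t : ℝ => Summable (fun x : ℤ => F 0 x t * F 1 x t + F 2 x t * F 3 x t)) (MeasureTheory.ae (MeasureTheory.volume.restrict (Set.Ioi (0:ℝ))))) ∧ MeasureTheory.IntegrableOn (fun t : ℝ => ∑' x : ℤ, (F 0 x t * F 1 x t + F 2 x t * F 3 x t)) (Set.Ioi 0) MeasureTheory.volume)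
    (h₃ : ∀ ω₂ lam β γ : ℝ, 0 < ω₂ → 0 < lam → 0 < β → 0 < γ → ∀ T : ℝ, 0 < T → ∀ (μ : MeasureTheory.Measure Literature.MathematicalPhysics.KineticTheory.HeatConduction.ChainConfig) (D : Literature.MathematicalPhysics.KineticTheory.HeatConduction.InfiniteChainDynamics (Literature.MathematicalPhysics.KineticTheory.HeatConduction.pinnedChain ω₂ lam β γ)), (Literature.MathematicalPhysics.KineticTheory.HeatConduction.pinnedChain ω₂ lam β γ).IsChainGibbsMeasure T μ →
      Literature.MathematicalPhysics.KineticTheory.HeatConduction.IsShiftInvariant μ →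
      D.PreservesMeasure μ → (∀ t : ℝ, D.HasAbsConvergentCorrelation μ t) → ((∀ (t : ℝ) (x : ℤ), MeasureTheory.Integrable (fun σ => (σ 0).1 * (D.flow t σ x).1) μ ∧ MeasureTheory.Integrable (fun σ => (σ 0).1 * (D.flow t σ x).2) μ ∧ MeasureTheory.Integrable (fun σ => (σ 0).2 * (D.flow t σ x).1) μ ∧ MeasureTheory.Integrable (fun σ => (σ 0).2 * (D.flow t σ x).2) μ) ∧ (∀ x : ℤ, MeasureTheory.IntegrableOn (fun t : ℝ => (MeasureTheory.integral μ (fun σ => (σ 0).1 * (D.flow t σ x).1)) ^ 2 + (MeasureTheory.integral μ (fun σ => (σ 0).1 * (D.flow t σ x).2)) ^ 2 + (MeasureTheory.integral μ (fun σ => (σ 0).2 * (D.flow t σ x).1)) ^ 2 + (MeasureTheory.integral μ (fun σ => (σ 0).2 * (D.flow t σ x).2)) ^ 2) (Set.Ioi 0) MeasureTheory.volume) ∧ Summable (fun x : ℤ => MeasureTheory.integral (MeasureTheory.volume.restrict (Set.Ioi (0:ℝ))) (fun t : ℝ => (MeasureTheory.integral μ (fun σ => (σ 0).1 * (D.flow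 t σ x).1)) ^ 2 + (MeasureTheory.integral μ (fun σ => (σ 0).1 * (D.flow t σ x).2)) ^ 2 + (MeasureTheory.integral μ (fun σ => (σ 0).2 * (D.flow t σ x).1)) ^ 2 + (MeasureTheory.integral μ (fun σ => (σ 0).2 * (D.flow t σ x).2)) ^ 2))) →
      ∀ F : Fin 4 → ℤ → ℝ → ℝ, F 0 = (fun (x : ℤ) (t : ℝ) => MeasureTheory.integral μ (fun σ => (((σ 0).2 + (σ 1).2) / 2) * (((D.flow t σ x).2 + (D.flow t σ (x + 1)).2) / 2))) →
      F 1 = (fun (x : ℤ) (t : ℝ) => MeasureTheory.integral μ (fun σ => ((σ 1).1 - (σ 0).1 + β * ((σ 1).1 - (σ 0).1) ^ 3) * ((D.flow t σ (x + 1)).1 - (D.flow t σ x).1 + β * ((D.flow t σ (x + 1)).1 - (D.flow t σ x).1) ^ 3))) →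
      F 2 = (fun (x : ℤ) (t : ℝ) => MeasureTheory.integral μ (fun σ => (((σ 0).2 + (σ 1).2) / 2) * ((D.flow t σ (x + 1)).1 - (D.flow t σ x).1 + β * ((D.flow t σ (x + 1)).1 - (D.flow t σ x).1) ^ 3))) →
      F 3 = (fun (x : ℤ) (t : ℝ) => MeasureTheory.integral μ (fun σ => ((σ 1).1 - (σ 0).1 + β * ((σ 1).1 - (σ 0).1) ^ 3) * (((D.flow t σ x).2 + (D.flow t σ (x + 1)).2) / 2))) →
      (∀ (i : Fin 4) (x : ℤ), MeasureTheory.AEStronglyMeasurable (F i x) (MeasureTheory.volume.restrict (Set.Ioi (0:ℝ)))) →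
      (∀ (i : Fin 4) (x : ℤ), MeasureTheory.IntegrableOn (fun t : ℝ => F i x t ^ 2) (Set.Ioi 0) MeasureTheory.volume) →
      (∀ i : Fin 4, Summable (fun x : ℤ => MeasureTheory.integral (MeasureTheory.volume.restrict (Set.Ioi (0:ℝ))) (fun t : ℝ => F i x t ^ 2))) →
      MeasureTheory.IntegrableOn (fun t : ℝ => ∑' x : ℤ, (MeasureTheory.integral μ (fun σ => (Literature.MathematicalPhysics.KineticTheory.HeatConduction.pinnedChain ω₂ lam β γ).bondCurrentZ σ 0 * (Literature.MathematicalPhysics.KineticTheory.HeatConduction.pinnedChain ω₂ lam β γ).bondCurrentZ (D.flow t σ) x) - (F 0 x t * F 1 x t + F 2 x t * F 3 x t))) (Set.Ioi 0) MeasureTheory.volume) :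
    ∀ ω₂ lam β γ : ℝ, 0 < ω₂ → 0 < lam → 0 < β → 0 < γ → ∀ T : ℝ, 0 < T → ∀ (μ : MeasureTheory.Measure Literature.MathematicalPhysics.KineticTheory.HeatConduction.ChainConfig) (D : Literature.MathematicalPhysics.KineticTheory.HeatConduction.InfiniteChainDynamics (Literature.MathematicalPhysics.KineticTheory.HeatConduction.pinnedChain ω₂ lam β γ)), (Literature.MathematicalPhysics.KineticTheory.HeatConduction.pinnedChain ω₂ lam β γ).IsChainGibbsMeasure T μ →
    Literature.MathematicalPhysics.KineticTheory.HeatConduction.IsShiftInvariant μ →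
    D.PreservesMeasure μ → (∀ t : ℝ, D.HasAbsConvergentCorrelation μ t) → (∀ (t : ℝ) (x : ℤ), MeasureTheory.Integrable (fun σ => (σ 0).1 * (D.flow t σ x).1) μ ∧ MeasureTheory.Integrable (fun σ => (σ 0).1 * (D.flow t σ x).2) μ ∧ MeasureTheory.Integrable (fun σ => (σ 0).2 * (D.flow t σ x).1) μ ∧ MeasureTheory.Integrable (fun σ => (σ 0).2 * (D.flow t σ x).2) μ) ∧ (∀ x : ℤ, MeasureTheory.IntegrableOn (fun t : ℝ => (MeasureTheory.integral μ (fun σ => (σ 0).1 * (D.flow t σ x).1)) ^ 2 + (MeasureTheory.integral μ (fun σ => (σ 0).1 * (D.flow t σ x).2)) ^ 2 + (MeasureTheory.integral μ (fun σ => (σ 0).2 * (D.flow t σ x).1)) ^ 2 + (MeasureTheory.integral μ (fun σ => (σ 0).2 * (D.flow t σ x).2)) ^ 2) (Set.Ioi 0) MeasureTheory.volume) ∧ Summable (fun x : ℤ => MeasureTheory.integral (MeasureTheory.volume.restrict (Set.Ioi (0:ℝ))) (fun t : ℝ => (MeasureTheory.integral μ (fun σ => (σ 0).1 * (D.flow t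 σ x).1)) ^ 2 + (MeasureTheory.integral μ (fun σ => (σ 0).1 * (D.flow t σ x).2)) ^ 2 + (MeasureTheory.integral μ (fun σ => (σ 0).2 * (D.flow t σ x).1)) ^ 2 + (MeasureTheory.integral μ (fun σ => (σ 0).2 * (D.flow t σ x).2)) ^ 2)) →
    MeasureTheory.IntegrableOn (D.currentCorrelation μ) (Set.Ioi 0) MeasureTheory.volume := by
  intro ω₂ lam β γ hω hl hβ hγ T hT μ D hG hS hP hA hOne
  -- the four composite two-point functions, packed as `F : Fin 4 → ℤ → ℝ → ℝ`
  obtain ⟨F, e0, e1, e2, e3⟩ := exists_fin4 (momBlock μ D) (forceBlock μ D) (momForceBlock μ D)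
    (forceMomBlock μ D)
  -- stub 1: integrability / measurability / L²(ℤ × (0,∞)) of the composite blocks
  obtain ⟨-, hM, hQ, hSm⟩ := h₁ ω₂ lam β γ hω hl hβ hγ T hT μ D hG hS hP hOne F e0 e1 e2 e3
  -- stub 2 (pure analysis): the pairing part is a.e.-summable in `x` and integrable in `t`
  obtain ⟨hGsum, hGint⟩ := h₂ F hM hQ hSm
  -- stub 3: the connected remainder is integrable in `t`
  have hKint := h₃ ω₂ lam β γ hω hl hβ hγ T hT μ D hG hS hP hA hOne F e0 e1 e2 e3 hM hQ hSm
  -- the current-correlation summands are summable at every time (absolute convergence hypothesis)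
  have hIsum : ∀ t : ℝ, Summable fun x : ℤ =>
      MeasureTheory.integral μ (fun σ => (Literature.MathematicalPhysics.KineticTheory.HeatConduction.pinnedChain ω₂ lam β γ).bondCurrentZ σ 0 * (Literature.MathematicalPhysics.KineticTheory.HeatConduction.pinnedChain ω₂ lam β γ).bondCurrentZ (D.flow t σ) x) :=
    fun t => (hA t).2.of_abs
  -- pairing part + connected part = C_T(t), for a.e. t > 0 (where the pairing part is summable)
  have hsplit : ∀ᵐ t ∂(MeasureTheory.volume.restrict (Set.Ioi (0:ℝ))),
      (fun t : ℝ => (∑' x : ℤ, (F 0 x t * F 1 x t + F 2 x t * F 3 x t)) +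
        ∑' x : ℤ, (MeasureTheory.integral μ
            (fun σ => (Literature.MathematicalPhysics.KineticTheory.HeatConduction.pinnedChain ω₂ lam β γ).bondCurrentZ σ 0 * (Literature.MathematicalPhysics.KineticTheory.HeatConduction.pinnedChain ω₂ lam β γ).bondCurrentZ (D.flow t σ) x) -
          (F 0 x t * F 1 x t + F 2 x t * F 3 x t))) t = D.currentCorrelation μ t := by
    filter_upwards [hGsum] with t ht
    have hK : Summable fun x : ℤ => MeasureTheory.integral μ
        (fun σ => (Literature.MathematicalPhysics.KineticTheory.HeatConduction.pinnedChain ω₂ lam β γ).bondCurrentZ σ 0 * (Literature.MathematicalPhysics.KineticTheory.HeatConduction.pinnedChain ω₂ lam β γ).bondCurrentZ (D.flow t σ) x) -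
          (F 0 x t * F 1 x t + F 2 x t * F 3 x t) := (hIsum t).sub ht
    calc (∑' x : ℤ, (F 0 x t * F 1 x t + F 2 x t * F 3 x t)) +
          ∑' x : ℤ, (MeasureTheory.integral μ
              (fun σ => (Literature.MathematicalPhysics.KineticTheory.HeatConduction.pinnedChain ω₂ lam β γ).bondCurrentZ σ 0 * (Literature.MathematicalPhysics.KineticTheory.HeatConduction.pinnedChain ω₂ lam β γ).bondCurrentZ (D.flow t σ) x) -
            (F 0 x t * F 1 x t + F 2 x t * F 3 x t))
        = ∑' x : ℤ, ((F 0 x t * F 1 x t + F 2 x t * F 3 x t) +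
            (MeasureTheory.integral μ
                (fun σ => (Literature.MathematicalPhysics.KineticTheory.HeatConduction.pinnedChain ω₂ lam β γ).bondCurrentZ σ 0 * (Literature.MathematicalPhysics.KineticTheory.HeatConduction.pinnedChain ω₂ lam β γ).bondCurrentZ (D.flow t σ) x) -
              (F 0 x t * F 1 x t + F 2 x t * F 3 x t))) := (ht.tsum_add hK).symm
      _ = ∑' x : ℤ, MeasureTheory.integral μ
            (fun σ => (Literature.MathematicalPhysics.KineticTheory.HeatConduction.pinnedChain ω₂ lam β γ).bondCurrentZ σ 0 * (Literature.MathematicalPhysics.KineticTheory.HeatConduction.pinnedChain ω₂ lam β γ).bondCurrentZ (D.flow t σ) x) :=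
          tsum_congr (fun x => by ring)
      _ = D.currentCorrelation μ t := rfl
  -- conclusion: C_T is integrable on (0, ∞)
  have hsum : MeasureTheory.Integrable
      (fun t : ℝ => (∑' x : ℤ, (F 0 x t * F 1 x t + F 2 x t * F 3 x t)) +
        ∑' x : ℤ, (MeasureTheory.integral μ
            (fun σ => (Literature.MathematicalPhysics.KineticTheory.HeatConduction.pinnedChain ω₂ lam β γ).bondCurrentZ σ 0 * (Literature.MathematicalPhysics.KineticTheory.HeatConduction.pinnedChain ω₂ lam β γ).bondCurrentZ (D.flow t σ) x) -
          (F 0 x t * F 1 x t + F 2 x t * F 3 x t)))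
      (MeasureTheory.volume.restrict (Set.Ioi (0:ℝ))) :=
    MeasureTheory.Integrable.add hGint hKint
  exact hsum.congr hsplit

/-- **Skeleton theorem — the crux `TangentFlowDephasing.LifetimeControlsCurrent` BY NAME from the registered
stubs** (the only theorem of this file concluding the crux; its `sorry`s are exactly those of the stubs; the seam
is the sorry-free `lifetimeControlsCurrent_of_parts`). -/
theorem LifetimeControlsCurrent_of :
    _root_.Summit.AtomisticToContinuum.FouriersLaw.Theses.TangentFlowDephasing.LifetimeControlsCurrent :=
  lifetimeControlsCurrent_of_parts stub_forceBlockL2 pairingL1 stub_connectedL1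

end Birth

end Summit.AtomisticToContinuum.FouriersLaw.Cruxes.LifetimeControlsCurrent

end
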